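import Mathlib
import Summits.QuantumFields.YangMills.Theorems.TransverseWardBLEntropyToVariance
import Summits.QuantumFields.YangMills.Theorems.TransverseWardBLConvexPhaseCalculus
import Literature.Analysis.FunctionSpaces.UniformlyConvexLogSobolevDomain
import HarnessLib

/-!
# The transverse Brascamp–Lieb (Poincaré) bound on one convex small-field sector

Route-independent helper for the crux stmt-QuantumFields-23103 `Theses.TransverseWardBL.ConvexPhaseCoexactBound`
(route `TransverseWardBL`, LINE g9-C of the ideator seat ym-idea-4; abelian `U(1)` line onto the leaf
`Theorems.U1HelicityGapTorusD4` — nothing here bears on the Yang–Mills mass gap).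

Setting: a linear isometry `ι : ℝʳ → ℝ^P` (the exact `2`-forms of a torus inside all plaquette `2`-forms, in
orthonormal coordinates), a centre `c ∈ ℝ^P` (a flux-sector representative), `β > 0`, and a test vector
`u ∈ ℝ^P` TRANSVERSE to the range of `ι` (`∑ u_p (ι h)_p = 0` for all `h`: co-closedness).  On the open convex
polytope `Ω = {x | ∀ p, |(ι x)_p − c_p| < 1}` with the log-concave weight `w = exp(β ∑_p cos((ι x)_p − c_p))`
(first-order `(β cos 1)`-convex potential, `neg_sum_cos_firstOrder_convex`) the test functional
`f(x) = ∑_p u_p sin((ι x)_p − c_p)` has transverse gradient `‖Df‖ ≤ (1 − cos 1)‖u‖`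
(`abs_sum_mul_cos_mul_le`), so the convex-domain entropy inequality of Bobkov–Ledoux
(`Literature.Analysis.FunctionSpaces.bobkovLedoux2000_prop31_convexDomain_exp`) and the extraction
`variance_le_of_hasEntropyExpC1c` give the `Z²`-multiplied variance bound

  `Z · ∫_Ω f² w − (∫_Ω f w)² ≤ ((1 − cos 1)²/(β cos 1)) ‖u‖² Z²`,  `Z = ∫_Ω w`

(`sectorPoincare_euclid`).  References: Brascamp–Lieb 1976 Thm 4.1; Bobkov–Ledoux 2000 Prop. 3.1; the
planner's line card for 23103 (ym-idea-4 g9).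
-/

noncomputable section

open MeasureTheory Set Filter Metric
open scoped Topology BigOperators RealInnerProductSpace

namespace Summit.QuantumFields.YangMills.Theorems.TransverseWardBL

open Literature.Analysis.FunctionSpaces

variable {P : Type*} [Fintype P]

/-- `‖v‖² = ∑_p v_p²` on `ℝ^P`. [folklore] -/
theorem euclidean_norm_sq_eq_sum_sq (v : EuclideanSpace ℝ P) : ‖v‖ ^ 2 = ∑ p, v p ^ 2 := by
  rw [EuclideanSpace.norm_eq, Real.sq_sqrt (Finset.sum_nonneg fun p _ => sq_nonneg _)]
  exact Finset.sum_congr rfl fun p _ => by rw [Real.norm_eq_abs, sq_abs]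

/-- `√(∑_p v_p²) = ‖v‖` on `ℝ^P`. [folklore] -/
theorem sqrt_sum_sq_eq_norm (v : EuclideanSpace ℝ P) : Real.sqrt (∑ p, v p ^ 2) = ‖v‖ := by
  rw [← euclidean_norm_sq_eq_sum_sq, Real.sqrt_sq (norm_nonneg _)]

/-- **Sector Poincaré bound (Euclidean coordinates).**  For a linear isometry `ι : ℝʳ → ℝ^P`, `u` transverse to
its range, `β > 0` and any centre `c`: with `Ω = {x | ∀ p, |(ι x)_p − c_p| < 1}`,
`w(x) = exp(β∑cos((ι x)_p − c_p))`, `f(x) = ∑ u_p sin((ι x)_p − c_p)`,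
`(∫_Ω w)(∫_Ω f² w) − (∫_Ω f w)² ≤ ((1 − cos 1)²/(β cos 1)) (∑ u_p²) (∫_Ω w)²`. [folklore] -/
theorem sectorPoincare_euclid {r : ℕ} (ι : EuclideanSpace ℝ (Fin r) →ₗᵢ[ℝ] EuclideanSpace ℝ P)
    (u : P → ℝ) (hu : ∀ h : EuclideanSpace ℝ (Fin r), ∑ p, u p * (ι h) p = 0) {β : ℝ} (hβ : 0 < β)
    (c : P → ℝ) :
    (∫ x in {x : EuclideanSpace ℝ (Fin r) | ∀ p, |(ι x) p - c p| < 1},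
        Real.exp (β * ∑ p, Real.cos ((ι x) p - c p))) *
      (∫ x in {x : EuclideanSpace ℝ (Fin r) | ∀ p, |(ι x) p - c p| < 1},
        (∑ p, u p * Real.sin ((ι x) p - c p)) ^ 2 * Real.exp (β * ∑ p, Real.cos ((ι x) p - c p))) -
      (∫ x in {x : EuclideanSpace ℝ (Fin r) | ∀ p, |(ι x) p - c p| < 1},
        (∑ p, u p * Real.sin ((ι x) p - c p)) * Real.exp (β * ∑ p, Real.cos ((ι x) p - c p))) ^ 2 ≤
    (1 - Real.cos 1) ^ 2 / (β * Real.cos 1) * (∑ p, u p ^ 2) *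
      (∫ x in {x : EuclideanSpace ℝ (Fin r) | ∀ p, |(ι x) p - c p| < 1},
        Real.exp (β * ∑ p, Real.cos ((ι x) p - c p))) ^ 2 := by
  set Ω : Set (EuclideanSpace ℝ (Fin r)) := {x | ∀ p, |(ι x) p - c p| < 1} with hΩ
  set wt : EuclideanSpace ℝ (Fin r) → ℝ := fun x => Real.exp (β * ∑ p, Real.cos ((ι x) p - c p)) with hwt
  set fu : EuclideanSpace ℝ (Fin r) → ℝ := fun x => ∑ p, u p * Real.sin ((ι x) p - c p) with hfu
  set S : ℝ := ∑ p, u p ^ 2 with hS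
  set K : ℝ := (1 - Real.cos 1) ^ 2 / (β * Real.cos 1) with hK
  have hcos1 : 0 < Real.cos 1 := Real.cos_pos_of_mem_Ioo ⟨by linarith [Real.pi_gt_three], by linarith [Real.pi_gt_three]⟩
  have hβc : 0 < β * Real.cos 1 := mul_pos hβ hcos1
  have hK0 : 0 ≤ K := by positivity
  have hS0 : 0 ≤ S := Finset.sum_nonneg fun p _ => sq_nonneg _
  -- continuity of the coordinates
  have hιc : ∀ p, Continuous fun x : EuclideanSpace ℝ (Fin r) => (ι x) p := fun p =>
    (EuclideanSpace.proj p : EuclideanSpace ℝ P →L[ℝ] ℝ).continuous.comp ι.continuous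
  have hwtc : Continuous wt := Real.continuous_exp.comp (continuous_const.mul
    (continuous_finsetSum _ fun p _ => Real.continuous_cos.comp ((hιc p).sub continuous_const)))
  have hfuc : Continuous fu :=
    continuous_finsetSum _ fun p _ => continuous_const.mul (Real.continuous_sin.comp
      ((hιc p).sub continuous_const))
  -- the domain: open, convex, bounded, measurable
  have hΩo : IsOpen Ω := by
    have : Ω = ⋂ p, {x | |(ι x) p - c p| < 1} := by ext x; simp [hΩ]
    rw [this]
    exact isOpen_iInter_of_finite fun p => isOpen_lt ((hιc p).sub continuous_const).abs continuous_const
  have hΩm : MeasurableSet Ω := hΩo.measurableSet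
  have hΩc : Convex ℝ Ω := by
    intro x hx y hy a b ha hb hab p
    have e : (ι (a • x + b • y)) p - c p = a * ((ι x) p - c p) + b * ((ι y) p - c p) := by
      rw [map_add, map_smul, map_smul, PiLp.add_apply, PiLp.smul_apply, PiLp.smul_apply, smul_eq_mul,
        smul_eq_mul]
      linear_combination (c p) * hab
    rw [e]
    rcases ha.eq_or_lt with rfl | ha'
    · simp only [zero_mul, zero_add] at hab ⊢
      rw [hab, one_mul]; exact hy p
    calc |a * ((ι x) p - c p) + b * ((ι y) p - c p)|
        ≤ |a * ((ι x) p - c p)| + |b * ((ι y) p - c p)| := abs_add_le _ _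
      _ = a * |(ι x) p - c p| + b * |(ι y) p - c p| := by
          rw [abs_mul, abs_mul, abs_of_nonneg ha, abs_of_nonneg hb]
      _ < a * 1 + b * 1 := add_lt_add_of_lt_of_le (mul_lt_mul_of_pos_left (hx p) ha')
          (mul_le_mul_of_nonneg_left (hy p).le hb)
      _ = 1 := by rw [mul_one, mul_one, hab]
  set R : ℝ := Real.sqrt (∑ p, (|c p| + 1) ^ 2) with hR
  have hR0 : 0 ≤ R := Real.sqrt_nonneg _
  have hΩR : ∀ x ∈ Ω, ‖x‖ ≤ R := by
    intro x hx
    rw [← ι.norm_map x, ← sqrt_sum_sq_eq_norm]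
    refine Real.sqrt_le_sqrt (Finset.sum_le_sum fun p _ => ?_)
    have h1 : |(ι x) p| ≤ |c p| + 1 := by
      have := hx p
      have h2 : |(ι x) p| ≤ |(ι x) p - c p| + |c p| := by
        calc |(ι x) p| = |((ι x) p - c p) + c p| := by ring_nf
          _ ≤ |(ι x) p - c p| + |c p| := abs_add_le _ _
      linarith
    calc (ι x) p ^ 2 = |(ι x) p| ^ 2 := (sq_abs _).symm
      _ ≤ (|c p| + 1) ^ 2 := pow_le_pow_left₀ (abs_nonneg _) h1 2
  have hΩbdd : Bornology.IsBounded Ω :=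
    (isBounded_closedBall (x := (0 : EuclideanSpace ℝ (Fin r))) (r := R)).subset fun x hx => by
      simpa using hΩR x hx
  have hΩfin : volume Ω < ⊤ := hΩbdd.measure_lt_top
  -- weight bounds
  have hwt_le : ∀ x, wt x ≤ Real.exp (β * Fintype.card P) := fun x => by
    refine Real.exp_le_exp.2 (mul_le_mul_of_nonneg_left ?_ hβ.le)
    calc ∑ p, Real.cos ((ι x) p - c p) ≤ ∑ _p : P, (1 : ℝ) :=
          Finset.sum_le_sum fun p _ => Real.cos_le_one _
      _ = Fintype.card P := by simp
  have hwt_pos : ∀ x, 0 < wt x := fun x => Real.exp_pos _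
  -- trivial case: the sector is (Lebesgue-)empty
  by_cases hΩ0 : volume Ω = 0
  · have h0 : ∀ F : EuclideanSpace ℝ (Fin r) → ℝ, ∫ x in Ω, F x = 0 := fun F => by
      rw [Measure.restrict_eq_zero.2 hΩ0, integral_zero_measure]
    rw [h0, h0, h0]
    simp
  haveI : NeZero (volume.restrict Ω) := ⟨fun h => hΩ0 (Measure.restrict_eq_zero.1 h)⟩
  -- the potential and the tilted (sector) probability measure
  set Vpot : EuclideanSpace ℝ (Fin r) → ℝ := fun x => -(β * ∑ p, Real.cos ((ι x) p - c p)) with hVpot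
  have hexpV : ∀ x, Real.exp (-Vpot x) = wt x := fun x => by simp [hVpot, hwt]
  have hZint : IntegrableOn (fun x => Real.exp (-Vpot x)) Ω volume := by
    refine Measure.integrableOn_of_bounded (M := Real.exp (β * Fintype.card P)) hΩfin.ne
      ((Real.continuous_exp.comp ((continuous_const.mul (continuous_finsetSum _ fun p _ =>
        Real.continuous_cos.comp ((hιc p).sub continuous_const))).neg).neg).aestronglyMeasurable)
      (ae_of_all _ fun x => ?_)
    rw [hexpV, Real.norm_eq_abs, abs_of_pos (hwt_pos x)]
    exact hwt_le x
  set ν : Measure (EuclideanSpace ℝ (Fin r)) := (volume.restrict Ω).tilted fun x => -Vpot x with hν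
  haveI hνprob : IsProbabilityMeasure ν := isProbabilityMeasure_tilted hZint
  have hνac : ν ≪ volume.restrict Ω := tilted_absolutelyContinuous _ _
  have hνΩ : ∀ᵐ x ∂ν, x ∈ Ω := hνac.ae_le (ae_restrict_mem hΩm)
  -- first-order uniform convexity of the potential on `Ω`
  have hVconv : ∀ x ∈ Ω, ∀ y ∈ Ω, Vpot x +
      ⟪(InnerProductSpace.toDual ℝ (EuclideanSpace ℝ (Fin r))).symm
        (β • ((∑ p, Real.sin ((ι x) p - c p) • (EuclideanSpace.proj p : EuclideanSpace ℝ P →L[ℝ] ℝ)).comp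
          ι.toContinuousLinearMap)), y - x⟫ + β * Real.cos 1 / 2 * ‖y - x‖ ^ 2 ≤ Vpot y := by
    intro x hx y hy
    rw [InnerProductSpace.toDual_symm_apply]
    have hxy : ‖y - x‖ ^ 2 = ∑ p, ((ι y) p - (ι x) p) ^ 2 := by
      rw [← ι.norm_map (y - x), euclidean_norm_sq_eq_sum_sq]
      refine Finset.sum_congr rfl fun p _ => ?_
      rw [map_sub, PiLp.sub_apply]
    have hlin : (β • ((∑ p, Real.sin ((ι x) p - c p) •
        (EuclideanSpace.proj p : EuclideanSpace ℝ P →L[ℝ] ℝ)).comp ι.toContinuousLinearMap)) (y - x) =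
        β * ∑ p, Real.sin ((ι x) p - c p) * ((ι y) p - (ι x) p) := by
      simp [PiLp.proj_apply, smul_eq_mul, map_sub]
      rw [← mul_sub, ← Finset.sum_sub_distrib]
      exact congrArg _ (Finset.sum_congr rfl fun p _ => by ring)
    rw [hlin, hxy]
    exact neg_sum_cos_firstOrder_convex hβ.le c (fun p => (ι x) p) (fun p => (ι y) p)
      (fun p => (hx p).le) (fun p => (hy p).le)
  have hVc : ContinuousOn Vpot Ω := ((continuous_const.mul (continuous_finsetSum _ fun p _ =>
    Real.continuous_cos.comp ((hιc p).sub continuous_const))).neg).continuousOn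
  have hEnt : HasEntropyExpC1c ν (1 / (β * Real.cos 1)) :=
    bobkovLedoux2000_prop31_convexDomain_exp hΩo hΩc hβc hVc hVconv hZint
  -- the test function, cut off far away
  let χ : ContDiffBump (0 : EuclideanSpace ℝ (Fin r)) := ⟨R + 1, R + 2, by linarith, by linarith⟩
  set g : EuclideanSpace ℝ (Fin r) → ℝ := fun x => χ x * fu x with hg
  have hfu_smooth : ContDiff ℝ 1 fu := by
    refine ContDiff.sum fun p _ => contDiff_const.mul (Real.contDiff_sin.comp ?_)
    exact ((EuclideanSpace.proj p : EuclideanSpace ℝ P →L[ℝ] ℝ).contDiff.comp ι.toContinuousLinearMap.contDiff).sub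
      contDiff_const
  have hg1 : ContDiff ℝ 1 g := (χ.contDiff (n := 1)).mul hfu_smooth
  have hgs : HasCompactSupport g := χ.hasCompactSupport.mul_right
  have hvar := variance_le_of_hasEntropyExpC1c hEnt hg1 hgs
  -- on `Ω` the cut-off is invisible
  have hball : ∀ x ∈ Ω, ball (0 : EuclideanSpace ℝ (Fin r)) (R + 1) ∈ 𝓝 x := fun x hx =>
    isOpen_ball.mem_nhds (by rw [mem_ball_zero_iff]; linarith [hΩR x hx])
  have hχ1 : ∀ y ∈ ball (0 : EuclideanSpace ℝ (Fin r)) (R + 1), χ y = 1 := fun y hy =>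
    χ.one_of_mem_closedBall (by
      rw [mem_closedBall_zero_iff]; rw [mem_ball_zero_iff] at hy; exact hy.le)
  have hgΩ : ∀ x ∈ Ω, g x = fu x := fun x hx => by
    simp only [hg, hχ1 x (mem_of_mem_nhds (hball x hx)), one_mul]
  have hgev : ∀ x ∈ Ω, g =ᶠ[𝓝 x] fu := fun x hx => by
    filter_upwards [hball x hx] with y hy
    simp only [hg, hχ1 y hy, one_mul]
  have hDgΩ : ∀ x ∈ Ω, fderiv ℝ g x = fderiv ℝ fu x := fun x hx => (hgev x hx).fderiv_eq
  -- the transverse gradient bound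
  have hDfu : ∀ x ∈ Ω, ‖fderiv ℝ fu x‖ ≤ (1 - Real.cos 1) * Real.sqrt S := by
    intro x hx
    have hder : HasFDerivAt fu
        ((∑ p, (u p * Real.cos ((ι x) p - c p)) •
          (EuclideanSpace.proj p : EuclideanSpace ℝ P →L[ℝ] ℝ)).comp ι.toContinuousLinearMap) x :=
      (hasFDerivAt_sum_mul_sin u c (ι x)).comp x ι.toContinuousLinearMap.hasFDerivAt
    rw [hder.fderiv]
    refine ContinuousLinearMap.opNorm_le_bound _
      (mul_nonneg (sub_nonneg.2 (Real.cos_le_one 1)) (Real.sqrt_nonneg _)) fun h => ?_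
    have happ : ((∑ p, (u p * Real.cos ((ι x) p - c p)) •
        (EuclideanSpace.proj p : EuclideanSpace ℝ P →L[ℝ] ℝ)).comp ι.toContinuousLinearMap) h =
        ∑ p, u p * Real.cos ((ι x) p - c p) * (ι h) p := by
      simp [PiLp.proj_apply, smul_eq_mul]
    rw [happ, Real.norm_eq_abs]
    have key := abs_sum_mul_cos_mul_le u (fun p => (ι h) p) (fun p => (ι x) p - c p) (hu h)
      (fun p => (hx p).le)
    rw [sqrt_sum_sq_eq_norm (ι h), ι.norm_map] at key
    exact key
  have hDg_sq : ∀ x ∈ Ω, ‖fderiv ℝ g x‖ ^ 2 ≤ (1 - Real.cos 1) ^ 2 * S := fun x hx => by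
    rw [hDgΩ x hx]
    have h1 := hDfu x hx
    have h2 : 0 ≤ (1 - Real.cos 1) * Real.sqrt S := by
      have := Real.cos_le_one 1; positivity
    calc ‖fderiv ℝ fu x‖ ^ 2 ≤ ((1 - Real.cos 1) * Real.sqrt S) ^ 2 :=
          pow_le_pow_left₀ (norm_nonneg _) h1 2
      _ = (1 - Real.cos 1) ^ 2 * S := by rw [mul_pow, Real.sq_sqrt hS0]
  -- replace `g` by `fu` under `ν`
  have e1 : ∫ x, g x ^ 2 ∂ν = ∫ x, fu x ^ 2 ∂ν :=
    integral_congr_ae (hνΩ.mono fun x hx => by simp only [hgΩ x hx])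
  have e2 : ∫ x, g x ∂ν = ∫ x, fu x ∂ν :=
    integral_congr_ae (hνΩ.mono fun x hx => by simp only [hgΩ x hx])
  have e3 : ∫ x, ‖fderiv ℝ g x‖ ^ 2 ∂ν ≤ (1 - Real.cos 1) ^ 2 * S := by
    have hDgc : Continuous fun x => ‖fderiv ℝ g x‖ ^ 2 :=
      ((hg1.continuous_fderiv one_ne_zero).norm).pow 2
    calc ∫ x, ‖fderiv ℝ g x‖ ^ 2 ∂ν ≤ ∫ _, (1 - Real.cos 1) ^ 2 * S ∂ν := by
          refine integral_mono_ae ?_ (integrable_const _) (hνΩ.mono fun x hx => hDg_sq x hx)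
          obtain ⟨Cg, hCg⟩ := (hg1.continuous_fderiv one_ne_zero).bounded_above_of_compact_support
            (hgs.fderiv (𝕜 := ℝ))
          exact Integrable.of_bound hDgc.aestronglyMeasurable (Cg ^ 2) (ae_of_all _ fun x => by
            rw [Real.norm_eq_abs, abs_of_nonneg (sq_nonneg _)]
            exact pow_le_pow_left₀ (norm_nonneg _) (hCg x) 2)
      _ = (1 - Real.cos 1) ^ 2 * S := by simp
  rw [e1, e2] at hvar
  have hvar' : ∫ x, fu x ^ 2 ∂ν - (∫ x, fu x ∂ν) ^ 2 ≤ K * S := by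
    have : 1 / (β * Real.cos 1) * ∫ x, ‖fderiv ℝ g x‖ ^ 2 ∂ν ≤ 1 / (β * Real.cos 1) * ((1 - Real.cos 1) ^ 2 * S) :=
      mul_le_mul_of_nonneg_left e3 (by positivity)
    have e : 1 / (β * Real.cos 1) * ((1 - Real.cos 1) ^ 2 * S) = K * S := by
      simp only [hK]; ring
    linarith
  -- un-normalise: integrals against `ν` are weighted set integrals over `Ω`
  set Z : ℝ := ∫ x in Ω, wt x with hZ
  have hZpos : 0 < Z := by
    simp only [hZ, hwt]
    exact integral_exp_pos (by
      have := hZint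
      simp only [hexpV, hwt] at this
      exact this)
  have htilt : ∀ F : EuclideanSpace ℝ (Fin r) → ℝ, ∫ x, F x ∂ν = (∫ x in Ω, F x * wt x) / Z := by
    intro F
    rw [hν, integral_tilted]
    simp only [hexpV, smul_eq_mul]
    rw [show (fun x => wt x / (∫ x in Ω, wt x) * F x) = fun x => Z⁻¹ * (F x * wt x) from
      funext fun x => by rw [← hZ]; ring, integral_const_mul]
    ring
  rw [htilt, htilt] at hvar'
  -- `(I₂/Z) − (I₁/Z)² ≤ K S` ⇒ `Z I₂ − I₁² ≤ K S Z²`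
  set I₂ : ℝ := ∫ x in Ω, fu x ^ 2 * wt x with hI₂
  set I₁ : ℝ := ∫ x in Ω, fu x * wt x with hI₁
  have hmul := mul_le_mul_of_nonneg_right hvar' (sq_nonneg Z)
  have e : (I₂ / Z - (I₁ / Z) ^ 2) * Z ^ 2 = Z * I₂ - I₁ ^ 2 := by
    field_simp
  rw [e] at hmul
  exact hmul

/-- **Sector Poincaré bound on a subspace `W ⊂ ℝ^P`** (the form consumed by the torus: `W` = exact
`2`-forms, integrals against the Lebesgue measure of the inner-product space `W`): for `u ⊥ W`, `β > 0`, any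
centre `c`, with `Ω = {v ∈ W | ∀ p, |v_p − c_p| < 1}`, `w = exp(β∑cos(v_p − c_p))`, `f = ∑ u_p sin(v_p − c_p)`,
`(∫_Ω w)(∫_Ω f² w) − (∫_Ω f w)² ≤ ((1 − cos 1)²/(β cos 1)) (∑ u_p²) (∫_Ω w)²`. [folklore] -/
theorem sectorPoincare_submodule (W : Submodule ℝ (EuclideanSpace ℝ P)) (u : P → ℝ)
    (hu : ∀ w ∈ W, ∑ p, u p * w p = 0) {β : ℝ} (hβ : 0 < β) (c : P → ℝ) :
    (∫ v in {v : W | ∀ p, |(v : EuclideanSpace ℝ P) p - c p| < 1},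
        Real.exp (β * ∑ p, Real.cos ((v : EuclideanSpace ℝ P) p - c p))) *
      (∫ v in {v : W | ∀ p, |(v : EuclideanSpace ℝ P) p - c p| < 1},
        (∑ p, u p * Real.sin ((v : EuclideanSpace ℝ P) p - c p)) ^ 2 *
          Real.exp (β * ∑ p, Real.cos ((v : EuclideanSpace ℝ P) p - c p))) -
      (∫ v in {v : W | ∀ p, |(v : EuclideanSpace ℝ P) p - c p| < 1},
        (∑ p, u p * Real.sin ((v : EuclideanSpace ℝ P) p - c p)) *
          Real.exp (β * ∑ p, Real.cos ((v : EuclideanSpace ℝ P) p - c p))) ^ 2 ≤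
    (1 - Real.cos 1) ^ 2 / (β * Real.cos 1) * (∑ p, u p ^ 2) *
      (∫ v in {v : W | ∀ p, |(v : EuclideanSpace ℝ P) p - c p| < 1},
        Real.exp (β * ∑ p, Real.cos ((v : EuclideanSpace ℝ P) p - c p))) ^ 2 := by
  set e : W ≃ₗᵢ[ℝ] EuclideanSpace ℝ (Fin (Module.finrank ℝ W)) := (stdOrthonormalBasis ℝ W).repr with he
  set ι : EuclideanSpace ℝ (Fin (Module.finrank ℝ W)) →ₗᵢ[ℝ] EuclideanSpace ℝ P :=
    W.subtypeₗᵢ.comp e.symm.toLinearIsometry with hι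
  have hιe : ∀ v : W, ι (e v) = (v : EuclideanSpace ℝ P) := fun v => by
    simp [hι, he]
  have hu' : ∀ h, ∑ p, u p * (ι h) p = 0 := fun h => hu _ (by simp [hι])
  have key := sectorPoincare_euclid ι u hu' hβ c
  have hmp : MeasurePreserving e volume volume := e.measurePreserving
  have hemb : MeasurableEmbedding e := e.toHomeomorph.measurableEmbedding
  have hpre : (e ⁻¹' {x | ∀ p, |(ι x) p - c p| < 1}) =
      {v : W | ∀ p, |(v : EuclideanSpace ℝ P) p - c p| < 1} := by
    ext v
    simp only [Set.mem_preimage, Set.mem_setOf_eq, hιe]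
  have tr : ∀ F : EuclideanSpace ℝ P → ℝ,
      ∫ x in {x | ∀ p, |(ι x) p - c p| < 1}, F (ι x) =
        ∫ v in {v : W | ∀ p, |(v : EuclideanSpace ℝ P) p - c p| < 1}, F (v : EuclideanSpace ℝ P) := by
    intro F
    rw [← hpre, ← hmp.setIntegral_preimage_emb hemb]
    simp only [hιe]
  have t1 := tr (fun z => Real.exp (β * ∑ p, Real.cos (z p - c p)))
  have t2 := tr (fun z => (∑ p, u p * Real.sin (z p - c p)) ^ 2 * Real.exp (β * ∑ p, Real.cos (z p - c p)))
  have t3 := tr (fun z => (∑ p, u p * Real.sin (z p - c p)) * Real.exp (β * ∑ p, Real.cos (z p - c p)))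
  simp only [] at t1 t2 t3
  rw [t1, t2, t3] at key
  exact key

end Summit.QuantumFields.YangMills.Theorems.TransverseWardBL

end
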